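import Summits.BirchSwinnertonDyer.BirchSwinnertonDyer.Theses.SignedLowerHalves
import Summits.BirchSwinnertonDyer.BirchSwinnertonDyer.Theorems.SignedSupersingularInputs
import HarnessLib

/-!
# `SignedLowerHalves.Assembly` holds (route SignedLowerHalves, item kind `assembly`, rank 1; item stmt-BirchSwinnertonDyer-19006)

The assembly `KobayashiLowerHalfSemistable → KobayashiLowerHalfLargeImage → KobayashiMainConjectureSmallImage →
SprungLowerHalfAtThree → SharpFlatResiduePPart → PublishedSignedInputs → SignedSupersingular` is exactly the landed
composition theorem `SignedSupersingular.signedSupersingular_of_lowerHalves` (Theorems/SignedSupersingularInputs.lean,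
p405667); the route items are its hypotheses verbatim, so the proof is delta-unfolding plus that theorem.
v2 (planner g10): no `open … in` — the statement is written and PRINTED fully qualified (hub dedup keys on the printed
type; a short `: Assembly` collided with an unrelated `…nbAssembly_proof`, director-bsd 2026-08-25T22:34:46Z/22:35:08Z).
File with: `ledger propose --kind proof --target Summits/BirchSwinnertonDyer/BirchSwinnertonDyer/Theorems/SignedLowerHalvesAssembly.lean
  --file <this> --workitem stmt-BirchSwinnertonDyer-19006`.
-/

set_option autoImplicit false
set_option linter.dupNamespace false

namespace Summit.BirchSwinnertonDyer.BirchSwinnertonDyer.Theorems.SignedLowerHalvesAssembly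

/-- The route's assembly item: the six lower-half / residual / published inputs imply the rung-K3 leaf. -/
theorem assembly_holds :
    Summit.BirchSwinnertonDyer.BirchSwinnertonDyer.Theses.SignedLowerHalves.Assembly := by
  intro hB1 hB2 hB2' hB3 hR8 hPub
  exact Summit.BirchSwinnertonDyer.BirchSwinnertonDyer.Theorems.SignedSupersingular.signedSupersingular_of_lowerHalves
    hB1 hB2 hB2' hB3 hR8 hPub

end Summit.BirchSwinnertonDyer.BirchSwinnertonDyer.Theorems.SignedLowerHalvesAssembly
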